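import Mathlib
import Summits.NavierStokesRegularity.NavierStokesRegularity.Theorems.ScenarioCensusPeriodicSlabMeanFree
import Summits.NavierStokesRegularity.NavierStokesRegularity.Theorems.ScenarioCensusPeriodicSlabSwirlFlux
import HarnessLib

/-!
# Census row S7, case (a): bounded periodic steady flows with axisymmetric swirl velocity are
# axial constants (Bang–Gui–Wang–Xie 2025, Thm 1.4 (a))

Support file for the scenario census of `NavierStokesRegularity` (cell `pub/ns-census`, block S,
row S7 = Bang–Gui–Wang–Xie, J. Fluid Mech. 1005 (2025) A6 = arXiv:2205.13259, Thm 1.4; tree FACT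
`Literature.Analysis.FluidPDE.BangGuiWangXie2025_periodicSlab_liouville`, first conjunct, first
disjunct). **Theorem** (`periodicSlab_liouville_swirlAxisymmetric`): for `ν > 0`, `L > 0`, a
smooth steady Navier–Stokes flow `(U, P)` on `ℝ³` (`IsLerayProfile ν 0 U P`, `U, P ∈ C^∞`),
bounded, axially `L`-periodic, whose swirl velocity `u^θ = swirlVelocity U` is an axisymmetric
scalar ("`u^θ` is independent of `θ`"), is an axial constant `U ≡ c e₃`. In particular
(`periodicSlab_liouville_axisymmetric`) every bounded AXISYMMETRIC smooth steady flow which is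
periodic along the axis is `(0, 0, c)` (loc. cit., the remark after Thm 1.4).

Proof: the swirl is axisymmetric, so the radial velocity has zero vertical period means
(`radial_verticalMean_eq_zero_of_swirl_axisymmetric`, BGWX §6 Step 1); hence `U` is constant
(`periodicSlab_liouville_of_radial_verticalMean`: periodic pressure, Poincaré–Wirtinger on vertical
periods, foot-point splitting of the pressure, dyadic Saint-Venant — the S6 chain), and a constant
field with axisymmetric `u^θ` is axial. No Bogovskiĭ map is used.

No summit statement is proved in this file; the census value of row S7 / a sub-row S7a is the
lead's call.

## References

* J. Bang, C. Gui, Y. Wang, C. Xie, arXiv:2205.13259, Thm 1.4 (a) and §6. [BangGuiWangXie2025]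
-/

-- the summit and its single problem share the name (D-0017 nested layout)
set_option linter.dupNamespace false

noncomputable section

open MeasureTheory Set Function Filter
open scoped Topology InnerProductSpace RealInnerProductSpace

namespace Summit.NavierStokesRegularity.NavierStokesRegularity.Theorems.ScenarioCensus.PeriodicSlab

open Literature.Analysis Literature.Analysis.FluidPDE
open Summit.NavierStokesRegularity.NavierStokesRegularity.Theorems.ScenarioCensus.HelicalSlab

/-- **Bang–Gui–Wang–Xie 2025, Thm 1.4 (a).** Let `ν > 0`, `L > 0`, and let `(U, P)` be a smooth
steady solution of the unforced Navier–Stokes system on `ℝ³` (`IsLerayProfile ν 0 U P`,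
`U, P ∈ C^∞`), bounded and axially `L`-periodic, whose swirl velocity `swirlVelocity U = u^θ` is
an axisymmetric scalar. Then `U ≡ c e₃` for some real `c`. -/
theorem periodicSlab_liouville_swirlAxisymmetric {ν L : ℝ} (hν : 0 < ν) (hL : 0 < L)
    {U : EuclideanSpace ℝ (Fin 3) → EuclideanSpace ℝ (Fin 3)} {P : EuclideanSpace ℝ (Fin 3) → ℝ}
    (hprof : IsLerayProfile ν 0 U P) (hU : ContDiff ℝ (⊤ : ℕ∞) U) (hP : ContDiff ℝ (⊤ : ℕ∞) P)
    (hbd : ∃ M : ℝ, ∀ x, ‖U x‖ ≤ M) (hper : IsAxiallyPeriodic L U)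
    (hsw : IsAxisymmetricScalar (swirlVelocity U)) :
    ∃ c : ℝ, U = fun _ => c • eZ := by
  obtain ⟨M, hM⟩ := hbd
  have hst : IsSteadyClassicalNS ν 0 U P := isSteadyClassicalNS_of_isLerayProfile hprof hU hP
  obtain ⟨K₁, K₂, K₃, -, -, -, hK⟩ := steady_derivative_bounds hν hst hM
  have hU1 : ContDiff ℝ 1 U := contDiff_infty.1 hU 1
  have hmean := radial_verticalMean_eq_zero_of_swirl_axisymmetric hU1 (fun x => (hK x).1)
    hst.divFree hper (isAxisymmetricScalar_swirl_of_swirlVelocity hsw)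
  obtain ⟨C, hC⟩ := periodicSlab_liouville_of_radial_verticalMean hν hL hprof hU hP ⟨M, hM⟩ hper hmean
  have hswC : IsAxisymmetricScalar (swirlVelocity fun _ : EuclideanSpace ℝ (Fin 3) => C) := by
    rw [← hC]; exact hsw
  have hCe : C = C 2 • eZ := eq_smul_eZ_of_const_of_swirlVelocity hswC
  exact ⟨C 2, by rw [hC]; funext x; exact hCe⟩

/-- **Bounded axisymmetric steady flows periodic along the axis are `(0, 0, c)`**
(Bang–Gui–Wang–Xie 2025, remark after Thm 1.4: axisymmetric solutions satisfy (a)). -/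
theorem periodicSlab_liouville_axisymmetric {ν L : ℝ} (hν : 0 < ν) (hL : 0 < L)
    {U : EuclideanSpace ℝ (Fin 3) → EuclideanSpace ℝ (Fin 3)} {P : EuclideanSpace ℝ (Fin 3) → ℝ}
    (hprof : IsLerayProfile ν 0 U P) (hU : ContDiff ℝ (⊤ : ℕ∞) U) (hP : ContDiff ℝ (⊤ : ℕ∞) P)
    (hbd : ∃ M : ℝ, ∀ x, ‖U x‖ ≤ M) (hper : IsAxiallyPeriodic L U) (hax : IsAxisymmetric U) :
    ∃ c : ℝ, U = fun _ => c • eZ := by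
  refine periodicSlab_liouville_swirlAxisymmetric hν hL hprof hU hP hbd hper fun θ x => ?_
  -- `u^θ (R_θ x) = ⟪R_θ U x, e_θ(R_θ x)⟫ = ⟪R_θ U x, R_θ e_θ x⟫ = u^θ x`
  show swirlVelocity U (rotZ θ x) = swirlVelocity U x
  by_cases hx : cylRadius x = 0
  · have hx' : cylRadius (rotZ θ x) = 0 := by rw [cylRadius_rotZ, hx]
    simp only [swirlVelocity, eTheta, hx, hx', inv_zero, zero_smul, inner_zero_right]
  · have hx' : cylRadius (rotZ θ x) ≠ 0 := by rw [cylRadius_rotZ]; exact hx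
    have h1 := hax.swirl_rotZ θ x
    rw [swirl_eq_cylRadius_mul_swirlVelocity U hx', swirl_eq_cylRadius_mul_swirlVelocity U hx,
      cylRadius_rotZ] at h1
    exact mul_left_cancel₀ hx h1

end Summit.NavierStokesRegularity.NavierStokesRegularity.Theorems.ScenarioCensus.PeriodicSlab

end
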